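import Literature.NumberTheory.CubicFields.DeloneFaddeevRing
import Mathlib.LinearAlgebra.Matrix.FixedDetMatrices
import Mathlib.LinearAlgebra.Matrix.SpecialLinearGroup
import HarnessLib

/-!
# `GL₂(ℤ)`-equivalent binary cubic forms have isomorphic cubic rings (Levi–Delone–Faddeev: the map on orbits is well defined)

Topic `Literature/NumberTheory/CubicFields`, continuing `BinaryCubicForms.lean` (the twisted
`GL₂(ℤ)`-action `twist`, `GL2ZEquiv`) and `DeloneFaddeevRing.lean` (the cubic ring `R(f)` with
basis `1, ω, θ`: `ωθ = −ad`, `ω² = −ac + bω − aθ`, `θ² = −bd + dω − cθ`).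

Bhargava–Taniguchi–Thorne 2023, Thm 2.1 (Levi, Delone–Faddeev, Gan–Gross–Savin): "There is a
canonical, discriminant-preserving bijection between the set of `GL₂(ℤ)`-orbits on `V(ℤ)` and the
set of isomorphism classes of cubic rings." This file PROVES the part of that statement saying
that `f ↦ R(f)` descends to orbits:

* `RingOfForm.nonempty_ringEquiv_of_gl2zEquiv` — **if `g = γ · f` with `γ ∈ GL₂(ℤ)` then
  `R(g) ≅ R(f)`** as rings.

Proof. `SL₂(ℤ)` is generated by `S = (0 −1; 1 0)` and `T = (1 1; 0 1)` (Mathlib: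
`SpecialLinearGroup.SL2Z_generators`); `f ∘ S = (−d, c, −b, a)` and `f ∘ T = (a+b+c+d, b+2c+3d,
c+3d, d)` (`subst_S`, `subst_T`), and explicit isomorphisms `R(f ∘ S) ≅ R(f)` (`ω' ↦ −θ`,
`θ' ↦ ω`; `sRingEquiv`) and `R(f ∘ T) ≅ R(f)` (`ω' ↦ ω + θ + (c + d)`, `θ' ↦ θ − d`; `tRingEquiv`)
are checked coordinatewise by `ring`; closure under products and inverses
(`f ∘ (γ₁γ₂) = (f ∘ γ₂) ∘ γ₁`) gives `R(f ∘ γ) ≅ R(f)` for all `γ ∈ SL₂(ℤ)`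
(`nonempty_ringEquiv_subst_of_det_eq_one`). A matrix of determinant `−1` is `γ₁ · diag(1, −1)`
with `γ₁ ∈ SL₂(ℤ)`, `f ∘ diag(1,−1) = (a, −b, c, −d)` with `R ≅ R(f)` via `ω ↦ −ω`
(`reflRingEquiv`), and the twist by `det γ = −1` replaces a form by its negative, `R(−f) ≅ R(f)`
via `ω ↦ −ω, θ ↦ −θ` (`negRingEquiv`).

NOT here: the converse (non-equivalent forms give non-isomorphic rings), surjectivity onto
isomorphism classes of cubic rings, and `Aut(R(f)) ≅ Stab(f)` — the remaining content of Thm 2.1.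

## References

* M. Bhargava, T. Taniguchi, F. Thorne, *Improved error estimates for the Davenport–Heilbronn
  theorems*, Math. Ann. 389 (2024) = arXiv:2107.12819, Thm 2.1 [BhargavaTaniguchiThorne2023].
* M. Bhargava, A. Shankar, J. Tsimerman, *On the Davenport–Heilbronn theorems and second order
  terms*, Invent. Math. 193 (2013), §2 [BhargavaShankarTsimerman2012].
* W. T. Gan, B. Gross, G. Savin, *Fourier coefficients of modular forms on `G₂`*, Duke Math. J.
  115 (2002), §4 [GanGrossSavin2002].
-/

namespace Literature.NumberTheory.CubicFields

open BinaryCubic Matrix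
open scoped MatrixGroups

namespace RingOfForm

/-! ### Transport along equal forms, and the three elementary isomorphisms -/

/-- Equal forms have (canonically) isomorphic rings. [folklore] -/
def castRingEquiv {F G : BinaryCubic ℤ} (h : F = G) : RingOfForm F ≃+* RingOfForm G := by
  subst h
  exact RingEquiv.refl _

/-- `f ∘ S = (−d, c, −b, a)` for `S = (0 −1; 1 0)`. [folklore] -/
theorem subst_S (f : BinaryCubic ℤ) : f.subst !![0, -1; 1, 0] = ⟨-f.d, f.c, -f.b, f.a⟩ := by
  ext <;> simp [BinaryCubic.subst]

/-- `f ∘ T = (a + b + c + d, b + 2c + 3d, c + 3d, d)` for `T = (1 1; 0 1)`. [folklore] -/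
theorem subst_T (f : BinaryCubic ℤ) :
    f.subst !![1, 1; 0, 1] = ⟨f.a + f.b + f.c + f.d, f.b + 2 * f.c + 3 * f.d, f.c + 3 * f.d, f.d⟩ := by
  (ext <;> simp [BinaryCubic.subst]); ring

/-- `f ∘ diag(1, −1) = (a, −b, c, −d)`. [folklore] -/
theorem subst_diag (f : BinaryCubic ℤ) : f.subst !![1, 0; 0, -1] = ⟨f.a, -f.b, f.c, -f.d⟩ := by
  ext <;> simp [BinaryCubic.subst]

/-- `(−1) • f = (−a, −b, −c, −d)`. [folklore] -/
theorem neg_one_smul_eq (f : BinaryCubic ℤ) : (-1 : ℤ) • f = ⟨-f.a, -f.b, -f.c, -f.d⟩ := by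
  ext <;> simp

/-- **`R(f ∘ S) ≅ R(f)`**: on `R((−d, c, −b, a))` the assignment `ω' ↦ −θ`, `θ' ↦ ω` (coordinates
`(x, y, z) ↦ (x, z, −y)`) is a ring isomorphism onto `R(f)`. [folklore] -/
def sRingEquiv (f : BinaryCubic ℤ) : RingOfForm (⟨-f.d, f.c, -f.b, f.a⟩ : BinaryCubic ℤ) ≃+* RingOfForm f where
  toFun P := ⟨P.x, P.z, -P.y⟩
  invFun Q := ⟨Q.x, -Q.z, Q.y⟩
  left_inv P := by ext <;> simp
  right_inv Q := by ext <;> simp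
  map_mul' P Q := by ext <;> simp <;> ring
  map_add' P Q := by ext <;> simp [add_comm]

/-- **`R(f ∘ T) ≅ R(f)`**: on `R((a+b+c+d, b+2c+3d, c+3d, d))` the assignment
`ω' ↦ ω + θ + (c + d)`, `θ' ↦ θ − d` (coordinates `(x, y, z) ↦ (x + (c+d)y − dz, y, y + z)`) is a
ring isomorphism onto `R(f)`. [folklore] -/
def tRingEquiv (f : BinaryCubic ℤ) :
    RingOfForm (⟨f.a + f.b + f.c + f.d, f.b + 2 * f.c + 3 * f.d, f.c + 3 * f.d, f.d⟩ : BinaryCubic ℤ)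
      ≃+* RingOfForm f where
  toFun P := ⟨P.x + (f.c + f.d) * P.y - f.d * P.z, P.y, P.y + P.z⟩
  invFun Q := ⟨Q.x - (f.c + f.d) * Q.y + f.d * (Q.z - Q.y), Q.y, Q.z - Q.y⟩
  left_inv P := by (ext <;> simp); ring
  right_inv Q := by (ext <;> simp); ring
  map_mul' P Q := by ext <;> simp <;> ring
  map_add' P Q := by ext <;> simp <;> ring

/-- **`R(f ∘ diag(1,−1)) ≅ R(f)`**: `ω ↦ −ω` (coordinates `(x, y, z) ↦ (x, −y, z)`). [folklore] -/
def reflRingEquiv (f : BinaryCubic ℤ) : RingOfForm (⟨f.a, -f.b, f.c, -f.d⟩ : BinaryCubic ℤ) ≃+* RingOfForm f where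
  toFun P := ⟨P.x, -P.y, P.z⟩
  invFun Q := ⟨Q.x, -Q.y, Q.z⟩
  left_inv P := by ext <;> simp
  right_inv Q := by ext <;> simp
  map_mul' P Q := by ext <;> simp <;> ring
  map_add' P Q := by ext <;> simp [add_comm]

/-- **`R(−f) ≅ R(f)`**: `ω ↦ −ω`, `θ ↦ −θ` (coordinates `(x, y, z) ↦ (x, −y, −z)`). [folklore] -/
def negRingEquiv (f : BinaryCubic ℤ) : RingOfForm (⟨-f.a, -f.b, -f.c, -f.d⟩ : BinaryCubic ℤ) ≃+* RingOfForm f where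
  toFun P := ⟨P.x, -P.y, -P.z⟩
  invFun Q := ⟨Q.x, -Q.y, -Q.z⟩
  left_inv P := by ext <;> simp
  right_inv Q := by ext <;> simp
  map_mul' P Q := by ext <;> simp <;> ring
  map_add' P Q := by ext <;> simp [add_comm]

/-! ### `SL₂(ℤ)`: induction over the generators `S`, `T` -/

/-- **`R(f ∘ γ) ≅ R(f)` for every `γ ∈ SL₂(ℤ)`** (induction over `SL₂(ℤ) = ⟨S, T⟩`,
`SpecialLinearGroup.SL2Z_generators`, using `sRingEquiv`, `tRingEquiv` and
`f ∘ (γ₁γ₂) = (f ∘ γ₂) ∘ γ₁`). [folklore] -/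
theorem nonempty_ringEquiv_subst_sl (γ : SL(2, ℤ)) (f : BinaryCubic ℤ) :
    Nonempty (RingOfForm (f.subst ↑γ) ≃+* RingOfForm f) := by
  have hmem : γ ∈ Subgroup.closure ({ModularGroup.S, ModularGroup.T} : Set (SL(2, ℤ))) := by
    rw [SpecialLinearGroup.SL2Z_generators]
    exact Subgroup.mem_top γ
  revert f
  refine Subgroup.closure_induction (p := fun (γ : SL(2, ℤ)) _ => ∀ f : BinaryCubic ℤ,
      Nonempty (RingOfForm (f.subst (γ : Matrix (Fin 2) (Fin 2) ℤ)) ≃+* RingOfForm f)) ?_ ?_ ?_ ?_ hmem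
  · -- generators
    intro x hx f
    simp only [Set.mem_insert_iff, Set.mem_singleton_iff] at hx
    rcases hx with rfl | rfl
    · rw [ModularGroup.coe_S]
      exact ⟨(castRingEquiv (subst_S f)).trans (sRingEquiv f)⟩
    · rw [ModularGroup.coe_T]
      exact ⟨(castRingEquiv (subst_T f)).trans (tRingEquiv f)⟩
  · -- identity
    intro f
    rw [Matrix.SpecialLinearGroup.coe_one]
    exact ⟨castRingEquiv (subst_one f)⟩
  · -- products
    intro x y _ _ hx hy f
    rw [Matrix.SpecialLinearGroup.coe_mul, subst_mul]
    obtain ⟨e₁⟩ := hx (f.subst ↑y)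
    obtain ⟨e₂⟩ := hy f
    exact ⟨e₁.trans e₂⟩
  · -- inverses
    intro x _ hx f
    obtain ⟨e⟩ := hx (f.subst ↑x⁻¹)
    have h : (f.subst (↑x⁻¹ : Matrix (Fin 2) (Fin 2) ℤ)).subst ↑x = f := by
      rw [← subst_mul, ← Matrix.SpecialLinearGroup.coe_mul, mul_inv_cancel,
        Matrix.SpecialLinearGroup.coe_one, subst_one]
    exact ⟨((castRingEquiv h).symm.trans e).symm⟩

/-- `R(f ∘ γ) ≅ R(f)` for an integral matrix `γ` with `det γ = 1`. [folklore] -/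
theorem nonempty_ringEquiv_subst_of_det_eq_one {γ : Matrix (Fin 2) (Fin 2) ℤ} (hγ : γ.det = 1)
    (f : BinaryCubic ℤ) : Nonempty (RingOfForm (f.subst γ) ≃+* RingOfForm f) :=
  nonempty_ringEquiv_subst_sl ⟨γ, hγ⟩ f

/-! ### `GL₂(ℤ)`: determinant `−1` and the twist -/

/-- `R(f ∘ γ) ≅ R(f)` for an integral matrix `γ` with `det γ = −1`: `γ = γ₁ · diag(1,−1)` with
`det γ₁ = 1`, and `R(f ∘ diag(1,−1)) ≅ R(f)` (`reflRingEquiv`). [folklore] -/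
theorem nonempty_ringEquiv_subst_of_det_eq_neg_one {γ : Matrix (Fin 2) (Fin 2) ℤ} (hγ : γ.det = -1)
    (f : BinaryCubic ℤ) : Nonempty (RingOfForm (f.subst γ) ≃+* RingOfForm f) := by
  set δ : Matrix (Fin 2) (Fin 2) ℤ := !![1, 0; 0, -1] with hδ
  have hδδ : δ * δ = 1 := by
    ext i j; fin_cases i <;> fin_cases j <;> simp [hδ]
  have hdetδ : δ.det = -1 := by simp [hδ, Matrix.det_fin_two_of]
  have h1 : (γ * δ).det = 1 := by rw [Matrix.det_mul, hγ, hdetδ]; norm_num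
  have hγeq : γ = (γ * δ) * δ := by rw [mul_assoc, hδδ, mul_one]
  obtain ⟨e₁⟩ := nonempty_ringEquiv_subst_of_det_eq_one h1 (f.subst δ)
  have e₂ : RingOfForm (f.subst δ) ≃+* RingOfForm f :=
    (castRingEquiv (subst_diag f)).trans (reflRingEquiv f)
  have hsub : f.subst γ = (f.subst δ).subst (γ * δ) := by
    conv_lhs => rw [hγeq]
    rw [subst_mul]
  exact ⟨(castRingEquiv hsub).trans (e₁.trans e₂)⟩

/-- **The Levi–Delone–Faddeev map is constant on `GL₂(ℤ)`-orbits up to isomorphism**: if `g` is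
`GL₂(ℤ)`-equivalent to `f` for the twisted action `γ · f = (det γ)⁻¹ f((u,v)γ)` of
Bhargava–Taniguchi–Thorne §2.2 (8) (`GL2ZEquiv f g`), then `R(g) ≅ R(f)` as rings — the
well-definedness of the orbit ↦ isomorphism-class map in BTT 2023, Thm 2.1.
[cite: BhargavaTaniguchiThorne2023, Theorem 2.1 (bijection on GL₂(ℤ)-orbits, well-definedness)] -/
theorem nonempty_ringEquiv_of_gl2zEquiv {f g : BinaryCubic ℤ} (h : GL2ZEquiv f g) :
    Nonempty (RingOfForm g ≃+* RingOfForm f) := by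
  obtain ⟨γ, hunit, rfl⟩ := h
  rcases Int.isUnit_iff.mp hunit with h1 | h1
  · -- `det γ = 1`: the twist is the plain substitution
    have htw : twist γ f = f.subst γ := by rw [twist, h1, one_smul]
    obtain ⟨e⟩ := nonempty_ringEquiv_subst_of_det_eq_one h1 f
    exact ⟨(castRingEquiv htw).trans e⟩
  · -- `det γ = −1`: the twist negates the substituted form
    have htw : twist γ f = (⟨-(f.subst γ).a, -(f.subst γ).b, -(f.subst γ).c, -(f.subst γ).d⟩ :
        BinaryCubic ℤ) := by
      rw [twist, h1, neg_one_smul_eq]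
    obtain ⟨e⟩ := nonempty_ringEquiv_subst_of_det_eq_neg_one h1 f
    exact ⟨(castRingEquiv htw).trans ((negRingEquiv (f.subst γ)).trans e)⟩

/-- Forms in the same `GL₂(ℤ)`-orbit have rings with the same discriminant (consistent with
`GL2ZEquiv.disc_eq` and `discr_basis_eq_disc`). [folklore] -/
theorem discr_basis_eq_of_gl2zEquiv {f g : BinaryCubic ℤ} (h : GL2ZEquiv f g) :
    Algebra.discr ℤ (basis g) = Algebra.discr ℤ (basis f) := by
  rw [discr_basis_eq_disc, discr_basis_eq_disc, h.disc_eq]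

end RingOfForm

end Literature.NumberTheory.CubicFields
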